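import Mathlib
import Summits.CriticalPhenomena.Ising3DConformalLimit.Theorems.PrecisionLaplacianEtaBoundsTransferEquation
import Summits.CriticalPhenomena.Ising3DConformalLimit.Theorems.PrecisionLaplacianEtaBoundsTransferGreen
import Literature.Probability.LatticeModels.HighDimTrivialityUniformProofs
import Literature.Probability.LatticeModels.CriticalTwoPointLawDimension
import HarnessLib

/-!
# The Green package for `G = criticalTwoPoint 3` (equation, no killing, Green representation)

Helper file for item `stmt-CriticalPhenomena-4804`
(`Summit.CriticalPhenomena.Ising3DConformalLimit.Theses.PrecisionLaplacian.EtaBoundsTransfer`), part of its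
unconditional proof: potential theory of inverse M-matrices ⇒ infinite-volume equation and Green-function
representation; Fourier analysis on `[-π,π]^d` ⇒ block-sum upper bounds; quadratic test function ⇒ ball-sum
lower bounds; Messager–Miracle-Solé ⇒ pointwise two-sided power bounds. No definitions are introduced: the
objects (kernel matrices, box sequences, convolution powers) enter through defining hypotheses. `G → 0` at
infinity is the Literature theorem `criticalTwoPoint_tendsto_zero_cofinite`; `χ(β_c) = ∞` in the form
`¬ Summable (criticalTwoPoint 3)` is derived here from the Simon–Lieb lower bound over shells.
-/

namespace Summit.CriticalPhenomena.Ising3DConformalLimit.Theorems.EtaBoundsTransfer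

open Finset Real Filter Topology Literature.Probability.LatticeModels
open scoped BigOperators ENNReal

section Package

/-- Shells of `ℤ³` are large: `|∂Λ_{k+1}| ≥ 24 (k+1)²` (indeed `= 24(k+1)² + 2`). -/
theorem card_sphere_three_ge (k : ℕ) : (24 : ℝ) * ((k : ℝ) + 1) ^ 2 ≤ #(sphere 3 (k + 1)) := by
  have h := card_sphere_succ_add (d := 3) k
  rw [card_box, card_box] at h
  have h' : (#(sphere 3 (k + 1)) : ℝ) = (2 * (k + 1) + 1 : ℝ) ^ 3 - (2 * k + 1 : ℝ) ^ 3 := by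
    have : ((#(sphere 3 (k + 1)) + (2 * k + 1) ^ 3 : ℕ) : ℝ) = (((2 * (k + 1) + 1) ^ 3 : ℕ) : ℝ) := by
      exact_mod_cast h
    push_cast at this
    linarith
  rw [h']
  nlinarith

/-- The critical two-point function of `ℤ³` is not summable (Simon–Lieb lower bound
`⟨σ₀σ_x⟩ ≥ c‖x‖^{-2}` summed over shells of size `≥ 24 m²`): `χ(β_c) = ∞`. -/
theorem criticalTwoPoint_not_summable : ¬ Summable (criticalTwoPoint 3) := by
  obtain ⟨c₀, C₀, hc₀, hbd⟩ := criticalTwoPoint_bounds_holds (d := 3) (by norm_num)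
  have hnn : ∀ x, 0 ≤ criticalTwoPoint 3 x := fun x => twoPointPlus_nonneg_of_gks (criticalBeta_nonneg 3) x
  intro hs
  -- shell lower bound: `∑_{∂Λ_m} G ≥ 24 c₀` for `m ≥ 1`
  have hshell : ∀ k : ℕ, 24 * c₀ ≤ ∑ x ∈ sphere 3 (k + 1), criticalTwoPoint 3 x := by
    intro k
    have hm : (0 : ℝ) < (k : ℝ) + 1 := by positivity
    have hterm : ∀ x ∈ sphere 3 (k + 1), c₀ * ((k : ℝ) + 1) ^ (-(2 : ℝ)) ≤ criticalTwoPoint 3 x := by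
      intro x hx
      have hsn : Site.supNorm x = k + 1 := mem_sphere.1 hx
      have hx0 : x ≠ 0 := by intro h; rw [h, Site.supNorm_eq_zero_iff.2 rfl] at hsn; omega
      have := (hbd x hx0).1
      rw [Site.norm_eq_supNorm, hsn, show -(((3 : ℕ) : ℝ) - 1) = -2 by norm_num] at this
      push_cast at this
      exact this
    calc 24 * c₀ = (24 * ((k : ℝ) + 1) ^ 2) * (c₀ * ((k : ℝ) + 1) ^ (-(2 : ℝ))) := by
          rw [Real.rpow_neg hm.le, Real.rpow_two]; field_simp
      _ ≤ (#(sphere 3 (k + 1)) : ℝ) * (c₀ * ((k : ℝ) + 1) ^ (-(2 : ℝ))) :=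
          mul_le_mul_of_nonneg_right (card_sphere_three_ge k) (by positivity)
      _ = ∑ x ∈ sphere 3 (k + 1), c₀ * ((k : ℝ) + 1) ^ (-(2 : ℝ)) := by
          rw [Finset.sum_const, nsmul_eq_mul]
      _ ≤ ∑ x ∈ sphere 3 (k + 1), criticalTwoPoint 3 x := Finset.sum_le_sum hterm
  -- box sums grow linearly
  have hbox : ∀ n : ℕ, 24 * c₀ * n ≤ ∑ x ∈ box 3 n, criticalTwoPoint 3 x := by
    intro n
    rw [sum_box_eq_sum_sphere, Finset.sum_range_succ']
    have h0 : 0 ≤ ∑ x ∈ sphere 3 0, criticalTwoPoint 3 x := Finset.sum_nonneg fun x _ => hnn x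
    have h1 : ∑ k ∈ Finset.range n, (24 * c₀) ≤ ∑ k ∈ Finset.range n, ∑ x ∈ sphere 3 (k + 1), criticalTwoPoint 3 x :=
      Finset.sum_le_sum fun k _ => hshell k
    rw [Finset.sum_const, Finset.card_range, nsmul_eq_mul] at h1
    linarith
  -- contradiction with summability
  set S := ∑' x, criticalTwoPoint 3 x with hS
  obtain ⟨n, hn⟩ := exists_nat_gt (S / (24 * c₀))
  have h1 : ∑ x ∈ box 3 n, criticalTwoPoint 3 x ≤ S := hs.sum_le_tsum _ fun x _ => hnn x
  have h2 : S < 24 * c₀ * n := by rwa [div_lt_iff₀ (by positivity), mul_comm] at hn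
  linarith [hbox n]

/-- `ℤ³` is infinite. -/
theorem infinite_site_three : Infinite (Site 3) :=
  Infinite.of_injective (fun n : ℤ => fun _ : Fin 3 => n) fun _ _ h => congr_fun h 0

/-- **The Green package.** Under the symmetric-potential hypothesis for `G = criticalTwoPoint 3`
and the two-sided tail bounds `c‖x‖^{-(5−η)} ≤ a(x) ≤ C‖x‖^{-(5−η)}` on the direct correlation
function, there are `A₀ > 0`, the even step weights `b = 𝟙_{≠0} a` with `∑ b = A₀` (no killing,
from `χ(β_c) = ∞`), and nonnegative summable convolution powers `P n` of `q = b/A₀` with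
`G = A₀⁻¹ ∑_n P n` (the Green-function representation), together with the infinite-volume
equation `A₀G − b∗G = δ`. -/
theorem green_package
    (hSP : ∀ A : Finset (Site 3), (Matrix.of fun (p q : ↥A) => criticalTwoPoint 3 (q.1 - p.1)).PosDef ∧
      ∀ u v : ↥A, (u ≠ v → (Matrix.of fun (p q : ↥A) => criticalTwoPoint 3 (q.1 - p.1))⁻¹ u v ≤ 0) ∧
        0 ≤ ∑ w, (Matrix.of fun (p q : ↥A) => criticalTwoPoint 3 (q.1 - p.1))⁻¹ u w)
    {η c C : ℝ} (hc : 0 < c)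
    (hbd : ∀ x : Site 3, x ≠ 0 → c * ‖x‖ ^ (-(5 - η)) ≤
      (⨅ A : {A : Finset (Site 3) // (0 : Site 3) ∈ A ∧ x ∈ A},
        -((Matrix.of fun (p q : ↥A.1) => criticalTwoPoint 3 (q.1 - p.1))⁻¹ ⟨0, A.2.1⟩ ⟨x, A.2.2⟩)) ∧
      (⨅ A : {A : Finset (Site 3) // (0 : Site 3) ∈ A ∧ x ∈ A},
        -((Matrix.of fun (p q : ↥A.1) => criticalTwoPoint 3 (q.1 - p.1))⁻¹ ⟨0, A.2.1⟩ ⟨x, A.2.2⟩))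
        ≤ C * ‖x‖ ^ (-(5 - η))) :
    ∃ (A₀ : ℝ) (b : Site 3 → ℝ) (P : ℕ → Site 3 → ℝ),
      0 < A₀ ∧ (∀ y, 0 ≤ b y) ∧ Summable b ∧ (∀ y, b (-y) = b y) ∧ ∑' y, b y = A₀ ∧
      (∀ y, y ≠ 0 → c * ‖y‖ ^ (-(5 - η)) ≤ b y) ∧ (∀ y, y ≠ 0 → b y ≤ C * ‖y‖ ^ (-(5 - η))) ∧
      (∀ z, A₀ * criticalTwoPoint 3 z - ∑' y, b y * criticalTwoPoint 3 (z - y) = if z = 0 then 1 else 0) ∧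
      (∀ z, P 0 z = if z = 0 then 1 else 0) ∧
      (∀ n z, P (n + 1) z = ∑' y, (b y / A₀) * P n (z - y)) ∧
      (∀ n z, 0 ≤ P n z) ∧ (∀ n, Summable (P n)) ∧ (∀ z, Summable fun n => P n z) ∧
      (∀ z, criticalTwoPoint 3 z = A₀⁻¹ * ∑' n, P n z) ∧
      (∀ z, 0 ≤ criticalTwoPoint 3 z) ∧ (∀ z, criticalTwoPoint 3 z ≤ criticalTwoPoint 3 0) := by
  haveI := infinite_site_three
  set G : Site 3 → ℝ := criticalTwoPoint 3 with hG
  set M : (A : Finset (Site 3)) → Matrix A A ℝ := fun A => Matrix.of fun (p q : ↥A) => G (q.1 - p.1)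
    with hMdef
  have hM : ∀ A, M A = Matrix.of fun (p q : ↥A) => G (q.1 - p.1) := fun A => rfl
  have hSP' : ∀ A : Finset (Site 3), (M A).PosDef ∧
      ∀ u v : ↥A, (u ≠ v → (M A)⁻¹ u v ≤ 0) ∧ 0 ≤ ∑ w, (M A)⁻¹ u w := hSP
  set a : Site 3 → ℝ := fun y => ⨅ A : {A : Finset (Site 3) // (0 : Site 3) ∈ A ∧ y ∈ A},
    -((M A.1)⁻¹ ⟨0, A.2.1⟩ ⟨y, A.2.2⟩) with hadef
  have ha : ∀ y, a y = ⨅ A : {A : Finset (Site 3) // (0 : Site 3) ∈ A ∧ y ∈ A},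
      -((M A.1)⁻¹ ⟨0, A.2.1⟩ ⟨y, A.2.2⟩) := fun y => rfl
  have hbd' : ∀ x : Site 3, x ≠ 0 → c * ‖x‖ ^ (-(5 - η)) ≤ a x ∧ a x ≤ C * ‖x‖ ^ (-(5 - η)) := hbd
  set k : ℕ → ℝ := fun n => (M (box 3 n))⁻¹ ⟨0, zero_mem_box 3 n⟩ ⟨0, zero_mem_box 3 n⟩ with hkdef
  have hk : ∀ n, k n = (M (box 3 n))⁻¹ ⟨0, zero_mem_box 3 n⟩ ⟨0, zero_mem_box 3 n⟩ := fun n => rfl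
  set t : ℕ → Site 3 → ℝ := fun n y => if hy : y ∈ box 3 n then
    -(M (box 3 n))⁻¹ ⟨0, zero_mem_box 3 n⟩ ⟨y, hy⟩ else 0 with htdef
  have ht : ∀ n y (hy : y ∈ box 3 n), t n y = -(M (box 3 n))⁻¹ ⟨0, zero_mem_box 3 n⟩ ⟨y, hy⟩ := by
    intro n y hy; simp only [htdef, dif_pos hy]
  -- facts about `G`
  have hGto : Tendsto G cofinite (𝓝 0) := criticalTwoPoint_tendsto_zero_cofinite
  have hGns : ¬ Summable G := criticalTwoPoint_not_summable
  have hGnn : ∀ x, 0 ≤ G x := apply_nonneg hM hSP'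
  have hGle : ∀ x, G x ≤ G 0 := fun x => by
    by_cases hx : x = 0
    · rw [hx]
    · exact (apply_lt_apply_zero hM hSP' hx).le
  -- the potential-theory chain
  obtain ⟨A₀, hkA, hkle, hA0⟩ := exists_A0 hM hSP' hGto hk
  obtain ⟨hsa, hsa_le⟩ := summable_a hSP' hk ht ha hkle
  have heq := limit_equation hM hSP' hGto hk ht ha hkA hkle
  set b : Site 3 → ℝ := fun y => if y = 0 then 0 else a y with hbdef
  have hb0 : ∀ y, 0 ≤ b y := fun y => by
    simp only [hbdef]; split_ifs with h
    · exact le_rfl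
    · exact a_nonneg hSP' ha h
  have hbev : ∀ y, b (-y) = b y := fun y => by
    by_cases hy : y = 0
    · simp [hbdef, hy]
    · simp only [hbdef, if_neg hy, if_neg (neg_ne_zero.2 hy)]
      exact a_neg hM hSP' ht ha hy
  have hblow : ∀ y, y ≠ 0 → c * ‖y‖ ^ (-(5 - η)) ≤ b y := fun y hy => by
    simp only [hbdef, if_neg hy]; exact (hbd' y hy).1
  have hbup : ∀ y, y ≠ 0 → b y ≤ C * ‖y‖ ^ (-(5 - η)) := fun y hy => by
    simp only [hbdef, if_neg hy]; exact (hbd' y hy).2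
  have hbpos : ∀ y, y ≠ 0 → 0 < b y := fun y hy =>
    lt_of_lt_of_le (mul_pos hc (Real.rpow_pos_of_pos (norm_pos_iff.2 hy) _)) (hblow y hy)
  -- convolution powers in `ℝ≥0∞`
  set Q : ℕ → Site 3 → ℝ≥0∞ := fun n => Nat.rec (fun z => if z = 0 then 1 else 0)
    (fun _ Qn z => ∑' y, ENNReal.ofReal (b y / A₀) * Qn (z - y)) n with hQdef
  have hQ0 : ∀ z, Q 0 z = if z = 0 then 1 else 0 := fun z => rfl
  have hQs : ∀ n z, Q (n + 1) z = ∑' y, ENNReal.ofReal (b y / A₀) * Q n (z - y) := fun n z => rfl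
  have hbA : ∑' y, b y = A₀ := tsum_b_eq hGnn hGle hGto hGns hb0 hbpos hsa hA0 hsa_le heq hQ0 hQs
  have hrepr := green_repr hGnn hGle hGto hb0 hbpos hsa hA0 hsa_le heq hQ0 hQs
  have hQle1 : ∀ n z, Q n z ≤ 1 := Q_le_one hb0 hsa hA0 hsa_le hQ0 hQs
  have hQfin : ∀ n z, Q n z ≠ ∞ := fun n z => ne_top_of_le_ne_top ENNReal.one_ne_top (hQle1 n z)
  -- the real convolution powers
  set P : ℕ → Site 3 → ℝ := fun n z => (Q n z).toReal with hPdef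
  have hq0 : ∀ y, 0 ≤ b y / A₀ := fun y => div_nonneg (hb0 y) hA0.le
  refine ⟨A₀, b, P, hA0, hb0, hsa, hbev, hbA, hblow, hbup, heq, ?_, ?_, ?_, ?_, ?_, ?_, hGnn, hGle⟩
  · intro z; simp only [hPdef, hQ0]; split_ifs <;> simp
  · intro n z
    simp only [hPdef]
    rw [hQs, ENNReal.tsum_toReal_eq (fun y => ENNReal.mul_ne_top ENNReal.ofReal_ne_top (hQfin n _))]
    refine tsum_congr fun y => ?_
    rw [ENNReal.toReal_mul, ENNReal.toReal_ofReal (hq0 y)]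
  · intro n z; exact ENNReal.toReal_nonneg
  · intro n
    have h := tsum_Q_eq_pow hb0 hsa hA0 hQ0 hQs n
    refine ENNReal.summable_toReal ?_
    rw [h]
    exact ENNReal.pow_ne_top ENNReal.ofReal_ne_top
  · intro z
    exact ENNReal.summable_toReal (tsum_Q_ne_top hGnn hGle hb0 hsa hA0 heq hQ0 hQs z)
  · intro z
    have h := hrepr z
    have hfin := tsum_Q_ne_top hGnn hGle hb0 hsa hA0 heq hQ0 hQs z
    have h2 : G z = ((ENNReal.ofReal A₀)⁻¹ * ∑' n, Q n z).toReal := by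
      rw [← h, ENNReal.toReal_ofReal (hGnn z)]
    rw [h2, ENNReal.toReal_mul, ENNReal.toReal_inv, ENNReal.toReal_ofReal hA0.le,
      ENNReal.tsum_toReal_eq (fun n => hQfin n z)]

end Package

end Summit.CriticalPhenomena.Ising3DConformalLimit.Theorems.EtaBoundsTransfer
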